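import Summits.ResolutionOfSingularities.ResolutionOfSingularities.Theorems.FrobeniusClosingSteerInsepStepPolyLemma
import Summits.ResolutionOfSingularities.ResolutionOfSingularities.Theorems.FrobeniusClosingSteerInsepStepChart
import Mathlib.Algebra.Polynomial.Inductions
import Mathlib.RingTheory.LocalRing.RingHom.Basic
import HarnessLib

/-!
# Steer / LEMMA I kernel, file F2b: THE MAXIMAL IDEAL OF THE NEW MEMBER AT A DEGREE-TWO INSEPARABLE NEAR POINT — `𝔪₁ = (X, z', t² − ℓ)`,
# the quotient `R̄ = S₁ ⧸ (X, z')` and the inputs of the polynomial lemma (PL₁)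

OURS (campaign res-hironaka, rung L ★L-G4, slot W4.1, crux `Steer` stmt-ResolutionOfSingularities-16345; res-L0-w41-plan-1 RULING 155a, kernel of
res-L0-w41-idea-3's LEMMA I `InsepStepNotIsolated`; res-L0-w41-stub-3 g7, blueprint `KERNEL-BLUEPRINT-LemmaI.md` 693d33707585fe97 §1; replaces the role
of no printed item; NOT a statement of the manuscript under review [claim: Hironaka2017, status: under-review]; AI review is weaker than expert review).
Theses-free, definition-free.

Setting (Case B of the blueprint): a quadratic transform `S₀ ≤ S₁` of local subrings of `L` with chart `X` and adapted parameters `𝔪₀ = (X, Y, Z)`,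
`t = Y/X`, `z' = Z/X ∈ S₁`, the near point has `z' ∈ 𝔪₁` and `t̄ ∉ κ₀` with `t² − ℓ ∈ 𝔪₁` (`ℓ ∈ S₀`; exponent-one inseparable residue growth).
* `exists_polynomial_eval_eq` — every element of `S₀[𝔪₀/X]` is `G(t, z')` for some `G ∈ S₀[T][Z']`;
* `eval_mem_span_of_eval_mem_maximalIdeal` — if `G(t, z') ∈ 𝔪₁` then `G(t, z') ∈ (X, z', t² − ℓ)` (Euclid by `Z'`, then by the monic `T² − ℓ`, clause (LI₁));
* `maximalIdeal_eq_span_triple` — **`𝔪₁ = (X, z', t² − ℓ) S₁`** (fractions `a/b` with `b ∈ S₁ˣ`);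
* `spanFinrank_eq_three`, `rsop_not_mem_sq` — it is a regular system of parameters of the three-dimensional regular `S₁`, so `X ∉ 𝔪₁²` (Matsumura 17.10);
* `isRegularLocalRing_quotient_pair`, `maximalIdeal_quotient_eq_span`, `mk_ne_zero_of_spanFinrank`, `mk_mem_map_maximalIdeal_iff` — the ring `R̄ := S₁ ⧸ (X, z')` is a
  regular local ring (hence a domain) with `𝔪_R̄ = (q̄)`, `q̄ ≠ 0`: the hypotheses of `LemmaI.polyLemma_one`.
[cite: Cutkosky2014, §2.1] [cite: Matsumura1987, Thm. 14.2, Thm. 17.10] [folklore]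
-/

noncomputable section

-- single-problem summit: the doubled namespace component `ResolutionOfSingularities` is forced
set_option linter.dupNamespace false

namespace Summit.ResolutionOfSingularities.ResolutionOfSingularities.Theorems.SwitchingDichotomy.LemmaI

open IsLocalRing Polynomial Literature.AlgebraicGeometry.Resolution

variable {L : Type} [Field L]

section Generators

variable {S₀ S₁ : Subring L} [IsLocalRing S₀] [IsLocalRing S₁]

omit [IsLocalRing S₁] in
/-- **Every element of `S₀[𝔪₀/X] = S₀[Y/X, Z/X]` is a polynomial in `t = Y/X`, `z' = Z/X` over `S₀`** (as a value of the two-step evaluation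
`S₀[T][Z'] → S₁`). [cite: Cutkosky2014, §2.1] -/
theorem exists_polynomial_eval_eq (h : S₀ ≤ S₁) {X Y Z : S₀} (hXYZ : Ideal.span {X, Y, Z} = maximalIdeal S₀) (hX0 : (X : L) ≠ 0)
    (t₁ z₁ : S₁) (ht₁ : (t₁ : L) = Y / X) (hz₁ : (z₁ : L) = Z / X) {w : L} (hw : w ∈ blowupRing S₀ (X : L)) :
    ∃ G : S₀[X][X], ((eval₂RingHom (eval₂RingHom (Subring.inclusion h) t₁) z₁ G : S₁) : L) = w := by
  set φ : S₀[X][X] →+* S₁ := eval₂RingHom (eval₂RingHom (Subring.inclusion h) t₁) z₁ with hφ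
  rw [blowupRing_eq_closure_triple hXYZ hX0] at hw
  induction hw using Subring.closure_induction with
  | mem v hv =>
    rcases hv with hv | hv
    · exact ⟨C (C ⟨v, hv⟩), by simp [hφ]⟩
    · rcases hv with rfl | rfl
      · exact ⟨C Polynomial.X, by simp [hφ, ht₁]⟩
      · exact ⟨Polynomial.X, by simp [hφ, hz₁]⟩
  | zero => exact ⟨0, by simp⟩
  | one => exact ⟨1, by simp⟩
  | add u w _ _ ihu ihw =>
    obtain ⟨G₁, hG₁⟩ := ihu
    obtain ⟨G₂, hG₂⟩ := ihw
    exact ⟨G₁ + G₂, by rw [map_add, Subring.coe_add, hG₁, hG₂]⟩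
  | neg u _ ihu =>
    obtain ⟨G₁, hG₁⟩ := ihu
    refine ⟨C (C (-1 : S₀)) * G₁, ?_⟩
    rw [map_mul, Subring.coe_mul, hG₁]
    simp [hφ]
  | mul u w _ _ ihu ihw =>
    obtain ⟨G₁, hG₁⟩ := ihu
    obtain ⟨G₂, hG₂⟩ := ihw
    exact ⟨G₁ * G₂, by rw [map_mul, Subring.coe_mul, hG₁, hG₂]⟩

/-- **Euclid at the near point.** With `z' ∈ 𝔪₁`, `t² − ℓ ∈ 𝔪₁` and the clause (LI₁) (`t̄ ∉ κ₀`): if `G(t, z') ∈ 𝔪₁` then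
`G(t, z') ∈ (X, z', t² − ℓ)`. (`G = G₀(T) + Z'·G'`; `G₀ = (T² − ℓ)A + b₀ + b₁T`; `b₀ + b₁ t ∈ 𝔪₁` forces `b₀, b₁ ∈ 𝔪₀ ⊆ X S₁`.) [folklore] -/
theorem eval_mem_span_of_eval_mem_maximalIdeal (hdom : SubringDominates S₀ S₁) {X : S₀} (hB : blowupRing S₀ (X : L) ≤ S₁)
    (hX0 : (X : L) ≠ 0) (t₁ z₁ : S₁) (hz₁m : z₁ ∈ maximalIdeal S₁)
    (ht : ∀ a : S₀, t₁ - Subring.inclusion hdom.1 a ∉ maximalIdeal S₁) (ℓ : S₀)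
    (hq : t₁ ^ 2 - Subring.inclusion hdom.1 ℓ ∈ maximalIdeal S₁)
    (G : S₀[X][X]) (hG : eval₂RingHom (eval₂RingHom (Subring.inclusion hdom.1) t₁) z₁ G ∈ maximalIdeal S₁) :
    eval₂RingHom (eval₂RingHom (Subring.inclusion hdom.1) t₁) z₁ G ∈
      Ideal.span {Subring.inclusion hdom.1 X, z₁, t₁ ^ 2 - Subring.inclusion hdom.1 ℓ} := by
  set ι := Subring.inclusion hdom.1 with hι
  set ψ : S₀[X] →+* S₁ := eval₂RingHom ι t₁ with hψ
  set φ : S₀[X][X] →+* S₁ := eval₂RingHom ψ z₁ with hφ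
  set J : Ideal S₁ := Ideal.span {ι X, z₁, t₁ ^ 2 - ι ℓ} with hJ
  have hXJ : ι X ∈ J := Ideal.subset_span (by simp)
  have hzJ : z₁ ∈ J := Ideal.subset_span (by simp)
  have hqJ : t₁ ^ 2 - ι ℓ ∈ J := Ideal.subset_span (by simp)
  -- split off the constant term in `Z'`
  have hsplit : φ G = z₁ * φ G.divX + ψ (G.coeff 0) := by
    have h1 : φ G = φ (Polynomial.X * G.divX + C (G.coeff 0)) := by rw [X_mul_divX_add]
    rw [h1, map_add, map_mul]
    simp only [hφ, coe_eval₂RingHom, eval₂_X, eval₂_C]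
  have hG0m : ψ (G.coeff 0) ∈ maximalIdeal S₁ := by
    have : ψ (G.coeff 0) = φ G - z₁ * φ G.divX := by rw [hsplit]; ring
    rw [this]
    exact Ideal.sub_mem _ hG (Ideal.mul_mem_right _ _ hz₁m)
  -- Euclid by `T² − ℓ`
  set Q : S₀[X] := Polynomial.X ^ 2 - C ℓ with hQ
  have hQm : Q.Monic := monic_X_pow_sub_C ℓ two_ne_zero
  have hQdeg : Q.degree = 2 := by rw [hQ, degree_X_pow_sub_C (by norm_num) ℓ]; rfl
  set A := G.coeff 0 /ₘ Q with hA
  set B := G.coeff 0 %ₘ Q with hB'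
  have hdiv : B + Q * A = G.coeff 0 := modByMonic_add_div _ Q
  have hBdeg : B.degree < 2 := by
    have := degree_modByMonic_lt (G.coeff 0) hQm
    rwa [hQdeg] at this
  have hBeq := eq_C_add_C_mul_X_of_degree_lt_two hBdeg
  have hQev : ψ Q = t₁ ^ 2 - ι ℓ := by simp [hψ, hQ]
  have hBev : ψ B = ι (B.coeff 0) + ι (B.coeff 1) * t₁ := by
    conv_lhs => rw [hBeq]
    simp [hψ]
  have hG0ev : ψ (G.coeff 0) = ψ B + (t₁ ^ 2 - ι ℓ) * ψ A := by
    rw [← hdiv, map_add, map_mul, hQev]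
  -- the remainder lies in `𝔪₁`, hence has coefficients in `𝔪₀ ⊆ X S₁ ⊆ J`
  have hBm : ι (B.coeff 0) + ι (B.coeff 1) * t₁ ∈ maximalIdeal S₁ := by
    have : ψ B = ψ (G.coeff 0) - (t₁ ^ 2 - ι ℓ) * ψ A := by rw [hG0ev]; ring
    rw [← hBev, this]
    exact Ideal.sub_mem _ hG0m (Ideal.mul_mem_right _ _ hq)
  obtain ⟨hb₀, hb₁⟩ := mem_and_mem_of_add_mul_mem hdom t₁ ht _ _ hBm
  have hXspan : Ideal.span {ι X} ≤ J := by
    rw [Ideal.span_le, Set.singleton_subset_iff]; exact hXJ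
  have hb₀J : ι (B.coeff 0) ∈ J := hXspan (inclusion_mem_span_exc hdom.1 hB hX0 hb₀)
  have hb₁J : ι (B.coeff 1) ∈ J := hXspan (inclusion_mem_span_exc hdom.1 hB hX0 hb₁)
  have hBJ : ψ B ∈ J := by
    rw [hBev]
    exact Ideal.add_mem _ hb₀J (Ideal.mul_mem_right _ _ hb₁J)
  have hG0J : ψ (G.coeff 0) ∈ J := by
    rw [hG0ev]
    exact Ideal.add_mem _ hBJ (Ideal.mul_mem_right _ _ hqJ)
  rw [show eval₂RingHom (eval₂RingHom (Subring.inclusion hdom.1) t₁) z₁ G = φ G from rfl, hsplit]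
  exact Ideal.add_mem _ (Ideal.mul_mem_right _ _ hzJ) hG0J

/-- **`𝔪₁ = (X, z', t² − ℓ) S₁`** at a degree-two inseparable near point with adapted coordinates (`z' ∈ 𝔪₁`, `t̄ ∉ κ₀`, `t̄² = ℓ̄`): every
`m ∈ 𝔪₁` is `a/b` with `a, b ∈ S₀[𝔪₀/X]`, `b ∈ S₁ˣ`, and `a = m·b ∈ 𝔪₁ ∩ S₀[t, z']` lies in the ideal by the Euclid lemma. [folklore] -/
theorem maximalIdeal_eq_span_triple (hQT : IsQuadraticTransform S₀ S₁) (hdom : SubringDominates S₀ S₁) {X Y Z : S₀}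
    (hXYZ : Ideal.span {X, Y, Z} = maximalIdeal S₀) (hX0 : (X : L) ≠ 0) (hB : blowupRing S₀ (X : L) ≤ S₁)
    (hfrac : ∀ w ∈ S₁, ∃ a ∈ blowupRing S₀ (X : L), ∃ b ∈ blowupRing S₀ (X : L), b⁻¹ ∈ S₁ ∧ w = a / b)
    (t₁ z₁ : S₁) (ht₁ : (t₁ : L) = Y / X) (hz₁ : (z₁ : L) = Z / X) (hz₁m : z₁ ∈ maximalIdeal S₁)
    (ht : ∀ a : S₀, t₁ - Subring.inclusion hdom.1 a ∉ maximalIdeal S₁) (ℓ : S₀)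
    (hq : t₁ ^ 2 - Subring.inclusion hdom.1 ℓ ∈ maximalIdeal S₁) :
    maximalIdeal S₁ = Ideal.span {Subring.inclusion hdom.1 X, z₁, t₁ ^ 2 - Subring.inclusion hdom.1 ℓ} := by
  have _ := hQT
  set ι := Subring.inclusion hdom.1 with hι
  apply le_antisymm
  · intro m hm
    obtain ⟨a, ha, b, hb, hbinv, hab⟩ := hfrac m m.2
    by_cases hb0 : b = 0
    · have : m = 0 := Subtype.ext (by rw [hab, hb0, div_zero]; rfl)
      rw [this]
      exact zero_mem _
    obtain ⟨G, hG⟩ := exists_polynomial_eval_eq hdom.1 hXYZ hX0 t₁ z₁ ht₁ hz₁ ha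
    set a₁ : S₁ := eval₂RingHom (eval₂RingHom ι t₁) z₁ G with ha₁
    have hma : a₁ = m * ⟨b, hB hb⟩ := Subtype.ext (by
      rw [Subring.coe_mul, hG, hab]; exact (div_mul_cancel₀ a hb0).symm)
    have ha₁m : a₁ ∈ maximalIdeal S₁ := by rw [hma]; exact Ideal.mul_mem_right _ _ hm
    have ha₁J := eval_mem_span_of_eval_mem_maximalIdeal hdom hB hX0 t₁ z₁ hz₁m ht ℓ hq G ha₁m
    have hm' : m = a₁ * ⟨b⁻¹, hbinv⟩ := Subtype.ext (by
      rw [Subring.coe_mul, hma, Subring.coe_mul]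
      change (m : L) = (m : L) * b * b⁻¹
      rw [mul_assoc, mul_inv_cancel₀ hb0, mul_one])
    rw [hm']
    exact Ideal.mul_mem_right _ _ ha₁J
  · rw [Ideal.span_le]
    rintro w hw
    simp only [Set.mem_insert_iff, Set.mem_singleton_iff] at hw
    rcases hw with rfl | rfl | rfl
    · exact (inclusion_mem_maximalIdeal_iff hdom X).mpr (mem_of_span_triple_eq hXYZ).1
    · exact hz₁m
    · exact hq

end Generators

/-! ## The regular system of parameters `(X, z', q)` of `S₁` and the quotient `R̄ = S₁ ⧸ (X, z')` -/

section Quotient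

variable {S₁ : Type*} [CommRing S₁] [IsRegularLocalRing S₁]

/-- A three-generated maximal ideal of a three-dimensional regular local ring: the generators are a regular system of parameters
(`spanFinrank 𝔪 = 3`). [cite: Matsumura1987, §14] -/
theorem spanFinrank_eq_three (hdim : ringKrullDim S₁ = 3) : (maximalIdeal S₁).spanFinrank = 3 := by
  have h := IsRegularLocalRing.spanFinrank_maximalIdeal (R := S₁)
  rw [hdim] at h
  exact_mod_cast h

/-- **Members of a regular system of parameters lie outside `𝔪²`** (Matsumura 17.10 for the degree-one form `X₀`). [cite: Matsumura1987, Thm. 17.10] -/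
theorem rsop_not_mem_sq {d : ℕ} (hd : (maximalIdeal S₁).spanFinrank = d) (x : Fin d → S₁)
    (hx : Ideal.span (Set.range x) = maximalIdeal S₁) (i : Fin d) : x i ∉ maximalIdeal S₁ ^ 2 := by
  intro h2
  have hhom : (MvPolynomial.X i : MvPolynomial (Fin d) S₁).IsHomogeneous 1 := MvPolynomial.isHomogeneous_X _ i
  have hev : MvPolynomial.eval x (MvPolynomial.X i : MvPolynomial (Fin d) S₁) ∈ maximalIdeal S₁ ^ (1 + 1) := by
    rw [MvPolynomial.eval_X]; exact h2
  have := coeff_mem_maximalIdeal_of_eval_mem_pow hd x hx hhom hev (Finsupp.single i 1)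
  -- the coefficient of `X_i` is `1 ∉ 𝔪`
  simp at this

/-- **The quotient by two of the three parameters is a regular local ring** (Matsumura Thm. 14.2 via the tree's
`isRegularLocalRing_quotient_span_image`). [cite: Matsumura1987, Thm. 14.2] -/
theorem isRegularLocalRing_quotient_pair (h3 : (maximalIdeal S₁).spanFinrank = 3) (a b c : S₁)
    (hspan : Ideal.span {a, b, c} = maximalIdeal S₁) : IsRegularLocalRing (S₁ ⧸ Ideal.span ({a, b} : Set S₁)) := by
  classical
  have hx : Ideal.span (Set.range ![a, b, c]) = maximalIdeal S₁ := by
    rw [Matrix.range_cons, Matrix.range_cons_cons_empty, Set.singleton_union]; exact hspan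
  have h := isRegularLocalRing_quotient_span_image h3 ![a, b, c] hx ({0, 1} : Finset (Fin 3))
  have himg : (![a, b, c] : Fin 3 → S₁) '' (({0, 1} : Finset (Fin 3)) : Set (Fin 3)) = {a, b} := by
    rw [Finset.coe_insert, Finset.coe_singleton, Set.image_insert_eq, Set.image_singleton]
    rfl
  rwa [himg] at h

/-- In the quotient `R̄ = S₁ ⧸ (a, b)` of a local ring with `𝔪 = (a, b, c)`, the maximal ideal is principal, generated by the class of `c`. [folklore] -/
theorem maximalIdeal_quotient_eq_span {S : Type*} [CommRing S] [IsLocalRing S] (a b c : S)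
    (hspan : Ideal.span {a, b, c} = maximalIdeal S) [IsLocalRing (S ⧸ Ideal.span ({a, b} : Set S))] :
    maximalIdeal (S ⧸ Ideal.span ({a, b} : Set S)) = Ideal.span {Ideal.Quotient.mk (Ideal.span ({a, b} : Set S)) c} := by
  rw [← IsLocalRing.map_maximalIdeal_of_surjective (Ideal.Quotient.mk (Ideal.span ({a, b} : Set S)))
    Ideal.Quotient.mk_surjective, ← hspan, Ideal.map_span, Set.image_insert_eq, Set.image_insert_eq, Set.image_singleton]
  have ha : Ideal.Quotient.mk (Ideal.span ({a, b} : Set S)) a = 0 :=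
    Ideal.Quotient.eq_zero_iff_mem.mpr (Ideal.subset_span (by simp))
  have hb : Ideal.Quotient.mk (Ideal.span ({a, b} : Set S)) b = 0 :=
    Ideal.Quotient.eq_zero_iff_mem.mpr (Ideal.subset_span (by simp))
  rw [ha, hb, Ideal.span_insert_zero, Ideal.span_insert_zero]

/-- The class of the third parameter is NON-ZERO in `S₁ ⧸ (a, b)` when `𝔪 = (a, b, c)` needs three generators. [folklore] -/
theorem mk_ne_zero_of_spanFinrank {S : Type*} [CommRing S] [IsLocalRing S] (a b c : S)
    (hspan : Ideal.span {a, b, c} = maximalIdeal S) (h3 : (maximalIdeal S).spanFinrank = 3) :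
    Ideal.Quotient.mk (Ideal.span ({a, b} : Set S)) c ≠ 0 := by
  intro h0
  rw [Ideal.Quotient.eq_zero_iff_mem] at h0
  have heq : Ideal.span ({a, b} : Set S) = maximalIdeal S := by
    apply le_antisymm
    · rw [← hspan]
      refine Ideal.span_mono fun w hw => ?_
      simp only [Set.mem_insert_iff, Set.mem_singleton_iff] at hw ⊢
      tauto
    · rw [← hspan, Ideal.span_le]
      rintro w hw
      simp only [Set.mem_insert_iff, Set.mem_singleton_iff] at hw
      rcases hw with rfl | rfl | rfl
      · exact Ideal.subset_span (by simp)
      · exact Ideal.subset_span (by simp)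
      · exact h0
  have hle : (maximalIdeal S).spanFinrank ≤ ({a, b} : Set S).ncard := by
    rw [← heq]
    exact Submodule.spanFinrank_span_le_ncard_of_finite (Set.toFinite _)
  have h2 : ({a, b} : Set S).ncard ≤ 2 := by
    calc ({a, b} : Set S).ncard ≤ ({b} : Set S).ncard + 1 := Set.ncard_insert_le a {b}
      _ = 2 := by rw [Set.ncard_singleton]
  omega

/-- Membership in the image of `𝔪` in a quotient by an ideal `I ≤ 𝔪`: `mk w ∈ 𝔪.map mk ↔ w ∈ 𝔪`. [folklore] -/
theorem mk_mem_map_maximalIdeal_iff {S : Type*} [CommRing S] [IsLocalRing S] {I : Ideal S} (hI : I ≤ maximalIdeal S) (w : S) :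
    Ideal.Quotient.mk I w ∈ (maximalIdeal S).map (Ideal.Quotient.mk I) ↔ w ∈ maximalIdeal S := by
  rw [← Ideal.mem_comap, Ideal.comap_map_of_surjective _ Ideal.Quotient.mk_surjective, ← RingHom.ker_eq_comap_bot,
    Ideal.mk_ker, sup_eq_left.mpr hI]

end Quotient

end Summit.ResolutionOfSingularities.ResolutionOfSingularities.Theorems.SwitchingDichotomy.LemmaI

end
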